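import Summits.ResolutionOfSingularities.ResolutionOfSingularities.Theorems.FrobeniusLadderFRationalResolutionVeroneseChartRegular
import Summits.ResolutionOfSingularities.ResolutionOfSingularities.Theorems.FrobeniusLadderFRationalResolutionVeronesePow
import Summits.ResolutionOfSingularities.ResolutionOfSingularities.Theorems.FrobeniusLadderFRationalResolutionVeroneseDegreeSplit
import Summits.ResolutionOfSingularities.ResolutionOfSingularities.Theorems.FrobeniusLadderFRationalResolutionBlowupSubcover
import Literature.AlgebraicGeometry.Resolution.AffineBlowupResolutionCriterion
import Literature.AlgebraicGeometry.Resolution.AffineBlowupRegular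
import HarnessLib

/-!
# Cone programme: RUNG 4′ ON ALL VERONESE CONES `V(n,r) = Spec k[χᵈ : |d| = r]`, EVERY FIELD — one blow-up of the vertex

Support file for crux stmt-ResolutionOfSingularities-15317 (`FrobeniusLadder.FRationalResolution`), line `redirect`,
CONE PROGRAMME (rung 4′ = `Scheme.HasResolution` in all dimensions on the Veronese cones; the composition announced by
lead c5 as `hasResolution_veroneseCone`, assembled here from the landed worker stubs). For every field `k`, all `n ≥ 1`
and `r ≥ 1`, the affine cone `V(n,r) = Spec VR[n,r]` over the `r`-th Veronese embedding of `ℙⁿ⁻¹`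
(`VR[n,r] = k[χᵈ : |d| = r] ⊆ k[x₁,…,xₙ]`; `= 𝔸ⁿ/μ_r` with weights `(1,…,1)`, wild for `p ∣ r`; singular for
`n, r ≥ 2`, `stub_veronese_vertex_not_regular`; a direct summand of `k[x]`, `stub_veronese_retract`) HAS A RESOLUTION
OF SINGULARITIES: the blowing up `Bl_{VM} V(n,r) → V(n,r)` of the vertex ideal `VM = (χᵈ : |d| = r)`. Proper and
birational by the tree's criterion `affineBlowup.isResolution_of_mem_nonZeroDivisors` (`VM` is finitely generated and
contains the non-zero-divisor `xᵢ₀ʳ` of the domain `VR[n,r]`); REGULAR because the `n` pure-power charts `D₊(xᵢʳ t)`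
already cover the blowing up (sub-cover criterion `stub_affineBlowup_cover_of_pow` fed by `stub_veronese_pow` /
`stub_finsupp_degree_split`: `(χᵈ)ʳ = xᵢʳ · q`, `q ∈ VM^{r-1}`, for any `i` with `dᵢ ≥ 1`) and each such chart is
`Spec VR[n,r][VM/xᵢʳ] ≅ 𝔸ⁿ` (`stub_veronese_chart_isRegularRing`, through `reesChartEquiv` and `Proj.awayι`).
[folklore; Kollár 2007 §2.2 (blow-up of a vertex); Görtz–Wedhorn Prop. 13.91 (4); Cox–Little–Schenck §10.1] -/

-- single-problem summit: the doubled namespace component is forced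
set_option linter.dupNamespace false

noncomputable section

namespace Summit.ResolutionOfSingularities.ResolutionOfSingularities.Theorems.FRationalResolution

open MvPolynomial AlgebraicGeometry TopologicalSpace
open Literature.AlgebraicGeometry.Resolution

section Cones

variable (k : Type) [Field k]

/-- The polynomial ring in `n` variables. -/
local notation3 "MP[" n "]" => MvPolynomial (Fin n) k

/-- The `r`-th Veronese subring of `k[x₁,…,xₙ]`: the `k`-subalgebra generated by the degree-`r` monomials. -/
local notation3 "VR[" n ", " r "]" =>
  Algebra.adjoin k ((fun d : Fin n →₀ ℕ => MvPolynomial.monomial d (1 : k)) ''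
    {d : Fin n →₀ ℕ | Finsupp.degree d = (r : ℕ)})

/-- The vertex ideal of the Veronese cone: spanned by the degree-`r` monomials. -/
local notation3 "VM[" n ", " r "]" =>
  Ideal.span {v : ↥VR[n, r] | ∃ d : Fin n →₀ ℕ, Finsupp.degree d = (r : ℕ) ∧
    (v : MvPolynomial (Fin n) k) = MvPolynomial.monomial d 1}

/-- The generating set `{χᵈ : |d| = r}` of the vertex ideal `VM[n,r]` is finite (the exponents lie in the finite
antidiagonal `Finset.univ.finsuppAntidiag r`). [folklore] -/
theorem veroneseCone_genSet_finite (n r : ℕ) :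
    {v : ↥VR[n, r] | ∃ d : Fin n →₀ ℕ, Finsupp.degree d = (r : ℕ) ∧ (v : MP[n]) = monomial d 1}.Finite := by
  classical
  have hD : {d : Fin n →₀ ℕ | Finsupp.degree d = (r : ℕ)}.Finite := by
    refine (Finset.finite_toSet ((Finset.univ : Finset (Fin n)).finsuppAntidiag r)).subset fun d hd => ?_
    rw [Finset.mem_coe, Finset.mem_finsuppAntidiag]
    refine ⟨?_, Finset.subset_univ _⟩
    rw [Set.mem_setOf_eq, Finsupp.degree_eq_sum] at hd
    exact hd
  refine (hD.dependent_image (fun d (hd : d ∈ {d : Fin n →₀ ℕ | Finsupp.degree d = (r : ℕ)}) =>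
    (⟨monomial d 1, Algebra.subset_adjoin ⟨d, hd, rfl⟩⟩ : ↥VR[n, r]))).subset ?_
  rintro v ⟨d, hd, hv⟩
  exact ⟨d, hd, Subtype.ext hv.symm⟩

/-- **RUNG 4′ ON ALL VERONESE CONES, EVERY FIELD.** For every field `k`, `r ≥ 1` and `n ≥ 1` (witnessed by
`i₀ : Fin n`) the affine cone `V(n,r) = Spec k[χᵈ : |d| = r]` over the `r`-th Veronese embedding of `ℙⁿ⁻¹` has a
resolution of singularities: the blowing up of its vertex ideal `VM`. The `n` pure-power charts `D₊(xᵢʳ t)` cover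
the blowing up (`stub_affineBlowup_cover_of_pow` with `stub_veronese_pow`, `stub_finsupp_degree_split`) and are affine
`n`-spaces (`stub_veronese_chart_isRegularRing` via `reesChartEquiv`, `Proj.awayι`), so the blowing up is regular
(`Scheme.IsRegular.of_forall_exists_isOpenImmersion`); it is proper birational by
`affineBlowup.isResolution_of_mem_nonZeroDivisors` (`VM` finitely generated, `xᵢ₀ʳ ∈ VM` a non-zero-divisor).
[folklore; Kollár 2007 §2.2; Görtz–Wedhorn Prop. 13.91 (4)] -/
theorem hasResolution_veroneseCone (n r : ℕ) (hr : 1 ≤ r) (i₀ : Fin n) :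
    Scheme.HasResolution (Spec (CommRingCat.of ↥VR[n, r])) := by
  classical
  -- the pure powers `xᵢʳ ∈ VM`
  have hXmem : ∀ i : Fin n, ((X i : MP[n]) ^ r) ∈ VR[n, r] := fun i =>
    Algebra.subset_adjoin ⟨Finsupp.single i r, Finsupp.degree_single i r, X_pow_eq_monomial.symm⟩
  let g : Fin n → ↥VR[n, r] := fun i => ⟨(X i : MP[n]) ^ r, hXmem i⟩
  have hgval : ∀ i, ((g i : ↥VR[n, r]) : MP[n]) = X i ^ r := fun i => rfl
  have hg : ∀ i, g i ∈ VM[n, r] := fun i =>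
    Ideal.subset_span ⟨Finsupp.single i r, Finsupp.degree_single i r, X_pow_eq_monomial⟩
  -- every generator power `(χᵈ)ʳ` is divisible by some `xᵢʳ` with cofactor in `VM^(r-1)`: the pure-power charts cover
  have hpow : ∀ s ∈ {v : ↥VR[n, r] | ∃ d : Fin n →₀ ℕ, Finsupp.degree d = (r : ℕ) ∧ (v : MP[n]) = monomial d 1},
      ∃ i, ∃ N : ℕ, ∃ q ∈ VM[n, r] ^ N, s ^ (N + 1) = g i * q := by
    rintro s ⟨d, hd, hs⟩
    exact stub_veronese_pow k n r hr (fun s d hd => stub_finsupp_degree_split r s d hd) g hgval s d hd hs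
  -- regularity of the blow-up: every point lies in a pure-power chart, which is an affine `n`-space
  have hreg : Scheme.IsRegular (affineBlowup VM[n, r]) := by
    refine Scheme.IsRegular.of_forall_exists_isOpenImmersion fun p => ?_
    obtain ⟨i, hi⟩ := stub_affineBlowup_cover_of_pow _ g hg hpow p
    haveI : IsRegularRing ↥(blowupAlgebra VM[n, r] (g i)) := stub_veronese_chart_isRegularRing k n r hr i (g i) rfl
    haveI : IsRegularRing (CommRingCat.of (HomogeneousLocalization.Away (reesGrading VM[n, r]) (reesT (g i) (hg i)))) :=
      IsRegularRing.of_ringEquiv (reesChartEquiv (g i) (hg i)).symm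
    refine ⟨_, Proj.awayι (reesGrading VM[n, r]) (reesT (g i) (hg i)) (reesT_mem (g i) (hg i)) Nat.one_pos,
      inferInstance, ?_, Scheme.isRegular_Spec _⟩
    rw [← Scheme.Hom.coe_opensRange, Proj.opensRange_awayι]
    exact hi
  -- `VM` is finitely generated and `xᵢ₀ʳ ∈ VM` is a non-zero-divisor of the domain `VR[n,r]`
  have hfg : (VM[n, r]).FG := Submodule.fg_span (veroneseCone_genSet_finite k n r)
  have hnzd : g i₀ ∈ nonZeroDivisors ↥VR[n, r] := by
    refine mem_nonZeroDivisors_of_ne_zero fun h => ?_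
    have h' := congrArg Subtype.val h
    simp only [g, ZeroMemClass.coe_zero, pow_eq_zero_iff', X_ne_zero, ne_eq, false_and] at h'
  exact ⟨affineBlowup VM[n, r], affineBlowup.π VM[n, r],
    affineBlowup.isResolution_of_mem_nonZeroDivisors hfg (hg i₀) hnzd hreg⟩

end Cones

end Summit.ResolutionOfSingularities.ResolutionOfSingularities.Theorems.FRationalResolution

end
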